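import Summits.KontsevichZagierPeriods.KontsevichZagierPeriods.Theses.FurushoPentagon
import Summits.KontsevichZagierPeriods.KontsevichZagierPeriods.Theorems.FurushoPentagonPentagonInKZHalfEdgeUniversalGeomAux
import Summits.KontsevichZagierPeriods.KontsevichZagierPeriods.Theorems.FurushoPentagonPentagonInKZHalfEdgeUniversalAlgebra
import Literature.NumberTheory.Transcendental.DrinfeldAssociatorProofs
import Literature.NumberTheory.Transcendental.KZRulesAssociator

/-!
# `PentagonInKZ`, line `logfree-gauge-corner-flatness`: stub `stub_halfEdgeUniversal`

The UNIVERSAL HALF-EDGE IDENTITY of the crux `PentagonInKZ` (stmt-KontsevichZagierPeriods-11348,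
route FurushoPentagon): with `A(X,Y) = (P 5)(X, Y, 0)` the log-free transport of
`X dt/t + Y dt/(t-1)` over `(0, ½)` from the tangential base point at `0`, `λ = χ[∫₀^{1/2} dt/(t-1)]`
and `Φ_χ` the `χ`-valued shuffle-regularised MZV series,
`A(Y,X) · e^{λY} · Φ_χ(X,Y) = A(X,Y) · e^{λX}` in every truncated Drinfeld–Kohno algebra — the
class-level form of `Φ_KZ = G₁(½)⁻¹ G₀(½)` [Drinfeld 1991, §2].

* `composition_formula` (the geometry): for a convergent word `v`,
  `(-1)^{#1(v)} χ[Δ_v] = Σ_k (-1)^k χ[I₅(σ(ṽ|_k))] χ[I₅(v|^k)]` — dissection of the MZV simplex by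
  the number of coordinates `> ½` (`HalfEdgeUniversal.dissect`), and on each piece the reflection
  `s = 1 - t` of the upper block (`halfEdgeUniversal_reflectPiece`) and Fubini (`KZ.of_mul_of`);
* `stub_halfEdgeUniversal` (the algebra): the right-hand side is the coefficient of the group-like
  series `S = G⁻A₀` (`G⁻` the antipode of `G = A₀(Y,X)`), so `Φ_χ = ⟨S, reg ·⟩`, and
  `halfEdgeUniversal_seriesIdentity` gives `G e^{λy} Φ_χ = A₀ e^{λx}`, which is evaluated in
  the nilpotent algebra (`NCSeries.evalTrunc_mul`).

References: V. G. Drinfeld, Leningrad Math. J. 2 (1991), §2; H. Furusho, Publ. RIMS 39 (2003),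
Prop. 3.2.3; M. Kontsevich, D. Zagier, *Periods* (2001), §1.2.
-/

noncomputable section

open Literature.NumberTheory.Transcendental MeasureTheory Set
open Literature.ModelTheory.ExponentialFields (IsSemialgebraic)

namespace Summit.KontsevichZagierPeriods.FurushoPentagon.PentagonInKZ.HalfEdgeUniversal

/-! ## 1. The composition formula at `t = ½` -/

section Composition

variable {R : Type} [CommRing R] (χ : KZ.FormalRep →+ R) (hrel : ∀ c ∈ KZ.relations, χ c = 0)
  (hmul : ∀ x y : KZ.FormalRep, χ (x * y) = χ x * χ y)
  (I5 : (w : List (Fin 3)) → KZ.IntegralRep w.length)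
  (hI5d : ∀ w : List (Fin 3), w.getLast? ≠ some 0 →
    (I5 w).domain = {t | (∀ i, 0 < t i ∧ t i < 1 / 2) ∧ StrictAnti t})
  (hI5i : ∀ w : List (Fin 3), w.getLast? ≠ some 0 → EqOn (I5 w).integrand
    (fun t => ∏ i, 1 / (t i - (![0, 1, 2] : Fin 3 → ℝ) (w.get i))) (I5 w).domain)
  (ι : Bool → Fin 3) (h0 : ι false = 0) (h1 : ι true = 1)
  (v : List Bool) (hv0 : v.head? = some false) (hv1 : v.getLast? = some true)

include hrel hmul hI5d hI5i h0 h1 hv0 hv1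

omit h0 h1 hv0 hv1 in
/-- **One piece of the dissection.** The piece `{t ∈ Δ | t_{k-1} > ½ > t_k}` of a simplex
representation with Kontsevich's integrand of the word `v`, read in product form along a
value-preserving relabelling, has `χ`-value `η · χ[I₅(ua)] · χ[I₅(wb)]` for the path words `ua`
(letters `¬v_{k-1-i}`) and `wb` (letters `v_{k+j}`), with the sign
`η = ∏_{i<k} (±1)(vᵢ) ∏ⱼ (∓1)(v_{k+j})` (reflection of the upper block, Fubini). [cite: Drinfeld1991, §2] -/
theorem piece_value (k : ℕ) (ua wb : List (Fin 3)) (hua0 : ua.getLast? ≠ some 0)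
    (hwb0 : wb.getLast? ≠ some 0) (hk' : ua.length = k) (hl' : wb.length = v.length - k)
    (hgu : ∀ i : Fin ua.length,
      (![0, 1, 2] : Fin 3 → ℝ) (ua.get i) = if (!(v.getD (Fin.rev i) false)) then 1 else 0)
    (hgw : ∀ j : Fin wb.length, (![0, 1, 2] : Fin 3 → ℝ) (wb.get j) = if v.getD (k + j) false then 1 else 0)
    (Qk : KZ.IntegralRep v.length) (e : Fin v.length ≃ Fin (ua.length + wb.length))
    (he : ∀ i, (e i : ℕ) = i)
    (hQd : Qk.domain = {t | (fun j => t (e.symm j)) ∈ {w : Fin (ua.length + wb.length) → ℝ |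
        (∀ i, 1 / 2 < w (Fin.castAdd _ i) ∧ w (Fin.castAdd _ i) < 1) ∧
        StrictAnti (fun i => w (Fin.castAdd _ i)) ∧
        (∀ j, 0 < w (Fin.natAdd _ j) ∧ w (Fin.natAdd _ j) < 1 / 2) ∧
        StrictAnti (fun j => w (Fin.natAdd _ j))}})
    (hQi : EqOn Qk.integrand (fun t => ∏ i : Fin v.length, KZ.mzvForm (v.getD i false) (t i))
      Qk.domain) :
    χ (KZ.of Qk) = (((∏ i ∈ Finset.range k, if v.getD i false then (1 : ℤ) else -1) *
        ∏ j ∈ Finset.range (v.length - k), if v.getD (k + j) false then (-1 : ℤ) else 1 : ℤ) : R) *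
      (χ (KZ.of (I5 ua)) * χ (KZ.of (I5 wb))) := by
  have hval := val_symm_eq e he
  -- the piece in product form
  have h1r : KZ.of Qk - KZ.of (Qk.reindex e) ∈ KZ.relations := KZ.of_sub_of_reindex_mem_relations Qk e
  have hRd : (Qk.reindex e).domain = {w : Fin (ua.length + wb.length) → ℝ |
      (∀ i, 1 / 2 < w (Fin.castAdd _ i) ∧ w (Fin.castAdd _ i) < 1) ∧
      StrictAnti (fun i => w (Fin.castAdd _ i)) ∧
      (∀ j, 0 < w (Fin.natAdd _ j) ∧ w (Fin.natAdd _ j) < 1 / 2) ∧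
      StrictAnti (fun j => w (Fin.natAdd _ j))} := by
    rw [KZ.IntegralRep.reindex_domain, hQd]
    ext w
    simp only [mem_setOf_eq, Equiv.apply_symm_apply]
  have hRi : EqOn (Qk.reindex e).integrand (fun w =>
      (∏ i : Fin ua.length, KZ.mzvForm (v.getD i false) (w (Fin.castAdd _ i))) *
        ∏ j : Fin wb.length, KZ.mzvForm (v.getD (k + j) false) (w (Fin.natAdd _ j)))
      (Qk.reindex e).domain := by
    intro w hw
    have hw' : (fun i => w (e i)) ∈ Qk.domain := hw
    rw [KZ.IntegralRep.reindex_integrand]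
    dsimp only
    rw [hQi hw']
    dsimp only
    rw [Fintype.prod_equiv e (fun i => KZ.mzvForm (v.getD i false) (w (e i)))
      (fun j => KZ.mzvForm (v.getD (e.symm j) false) (w j)) (fun i => by simp), Fin.prod_univ_add]
    congr 1
    · exact Finset.prod_congr rfl fun i _ => by simp [hval]
    · exact Finset.prod_congr rfl fun j _ => by simp [hval, hk']
  -- the two half-transports
  have hUi : EqOn (I5 ua).integrand
      (fun s => ∏ i, 1 / (s i - if (!(v.getD (Fin.rev i) false)) then 1 else 0)) (I5 ua).domain := by
    intro s hs
    rw [hI5i ua hua0 hs]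
    exact Finset.prod_congr rfl fun i _ => by rw [hgu]
  have hVi : EqOn (I5 wb).integrand
      (fun s => ∏ j, 1 / (s j - if v.getD (k + j) false then 1 else 0)) (I5 wb).domain := by
    intro s hs
    rw [hI5i wb hwb0 hs]
    exact Finset.prod_congr rfl fun j _ => by rw [hgw]
  -- the sign
  set η : ℤ := (∏ i : Fin ua.length, if v.getD i false then (1 : ℤ) else -1) *
    ∏ j : Fin wb.length, if v.getD (k + j) false then (-1 : ℤ) else 1 with hη
  have hηeq : η = (∏ i ∈ Finset.range k, if v.getD i false then (1 : ℤ) else -1) *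
      ∏ j ∈ Finset.range (v.length - k), if v.getD (k + j) false then (-1 : ℤ) else 1 := by
    rw [hη, Fin.prod_univ_eq_prod_range (fun i => if v.getD i false then (1 : ℤ) else -1),
      Fin.prod_univ_eq_prod_range (fun j => if v.getD (k + j) false then (-1 : ℤ) else 1), hk', hl']
  have hηsq : η * η = 1 := by
    rw [hη, mul_mul_mul_comm, prod_sign_mul_self _ _ (by norm_num) (by norm_num),
      prod_sign_mul_self _ _ (by norm_num) (by norm_num), mul_one]
  -- the reflection move
  have key : ∀ T : KZ.IntegralRep (ua.length + wb.length),
      T.domain = KZ.IntegralRep.prodDomain (I5 ua) (I5 wb) →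
      EqOn T.integrand (fun w => (η : ℝ) * KZ.IntegralRep.prodFun (I5 ua) (I5 wb) w) T.domain →
      KZ.of (Qk.reindex e) - KZ.of T ∈ KZ.relations := fun T hTd hTi =>
    reflect_piece (fun i => v.getD i false) (fun j => v.getD (k + j) false)
      (fun i => !(v.getD (Fin.rev i) false)) (fun _ => rfl) (Qk.reindex e) hRd hRi (I5 ua)
      (hI5d ua hua0) hUi (I5 wb) (hI5d wb hwb0) hVi (η : ℝ) (by rw [hη]; push_cast; rfl) T hTd hTi
  have hprod : χ (KZ.of (I5 ua) * KZ.of (I5 wb)) = χ (KZ.of (I5 ua)) * χ (KZ.of (I5 wb)) := hmul _ _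
  rw [← hηeq, chi_eq_of_sub_mem χ hrel h1r]
  rcases Int.eq_one_or_neg_one_of_mul_eq_one hηsq with h1' | h1'
  · have h2 := key ((I5 ua).prod (I5 wb)) rfl (by
      rw [KZ.IntegralRep.prod_integrand_eq]; intro w _; simp [h1'])
    rw [chi_eq_of_sub_mem χ hrel h2, ← KZ.of_mul_of, hprod, h1', Int.cast_one, one_mul]
  · have h2 := key ((I5 ua).prod (I5 wb)).neg rfl (by
      rw [KZ.IntegralRep.integrand_neg, KZ.IntegralRep.prod_integrand_eq]; intro w _; simp [h1'])
    have h3 : KZ.of ((I5 ua).prod (I5 wb)) + KZ.of ((I5 ua).prod (I5 wb)).neg ∈ KZ.relations :=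
      KZ.of_add_of_mem_relations_of_eqOn_neg rfl (fun _ _ => rfl)
    have h4 := hrel _ h3
    rw [map_add, ← KZ.of_mul_of, hprod, add_comm, add_eq_zero_iff_eq_neg] at h4
    rw [chi_eq_of_sub_mem χ hrel h2, h4, h1', Int.cast_neg, Int.cast_one, neg_one_mul]

/-- **The composition formula at `t = ½`** (class-level `Φ = G₁(½)⁻¹ G₀(½)`, one convergent
coefficient): for a convergent word `v` (starting with `0`, ending with `1`) and a representation
`Q` of the MZV simplex `{1 > t₀ > ⋯ > t_{n-1} > 0}` with Kontsevich's integrand `∏ ω_{vᵢ}(tᵢ)`,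
`(-1)^{#1(v)} χ[Q] = Σ_{k=0}^{n} (-1)^k χ[I₅(σ(ṽ|_k))] χ[I₅(v|^k)]`, where `I₅(w)` is the path-5
simplex `{½ > s₀ > ⋯ > 0}` with `∏ 1/(sᵢ - c(wᵢ))` and `σ` exchanges the two letters: dissect by
the number `k` of coordinates `> ½` (the walls `{tᵢ = ½}` are null), reflect the upper block
by `s = 1 - t` (an affine change of variables), Fubini. [cite: Drinfeld1991, §2] -/
theorem composition_formula {m : ℕ} (hm : m = v.length) (Q : KZ.IntegralRep m)
    (hQd : Q.domain = {t | (∀ i, 0 < t i) ∧ (∀ i, t i < 1) ∧ StrictAnti t})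
    (hQi : EqOn Q.integrand (fun t => ∏ i : Fin m, KZ.mzvForm (v.getD i false) (t i)) Q.domain) :
    (-1 : R) ^ (v.count true) * χ (KZ.of Q) = ∑ k ∈ Finset.range (v.length + 1), (-1 : R) ^ k *
      (χ (KZ.of (I5 (((v.take k).reverse.map not).map ι))) * χ (KZ.of (I5 ((v.drop k).map ι)))) := by
  subst hm
  have hlen : ∀ k, v.length =
      (((v.take k).reverse.map not).map ι).length + ((v.drop k).map ι).length := fun k => by
    simp only [List.length_map, List.length_reverse, List.length_take, List.length_drop]; omega
  have hku : ∀ k, k ≤ v.length → (((v.take k).reverse.map not).map ι).length = k := fun k hk => by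
    simp [min_eq_left hk]
  set e : (k : ℕ) → Fin v.length ≃
      Fin ((((v.take k).reverse.map not).map ι).length + ((v.drop k).map ι).length) :=
    fun k => finCongr (hlen k) with hedef
  have he : ∀ k i, (e k i : ℕ) = i := fun k i => by simp [hedef]
  set D : ℕ → Set (Fin v.length → ℝ) := fun k => {t | (fun j => t ((e k).symm j)) ∈
      {w : Fin ((((v.take k).reverse.map not).map ι).length + ((v.drop k).map ι).length) → ℝ |
        (∀ i, 1 / 2 < w (Fin.castAdd _ i) ∧ w (Fin.castAdd _ i) < 1) ∧
        StrictAnti (fun i => w (Fin.castAdd _ i)) ∧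
        (∀ j, 0 < w (Fin.natAdd _ j) ∧ w (Fin.natAdd _ j) < 1 / 2) ∧
        StrictAnti (fun j => w (Fin.natAdd _ j))}} with hDdef
  have hDs : ∀ k, IsSemialgebraic ℚ (D k) := fun k => (isSemialgebraic_cell _ _).preimage_comp _
  have hDsub : ∀ k, D k ⊆ Q.domain := fun k => by
    rw [hQd]; exact preimage_cell_subset_simplex (e k) (he k)
  have hcov : ∀ t ∈ Q.domain, (∀ i, t i ≠ 1 / 2) → ∃ k ∈ Finset.range (v.length + 1), t ∈ D k := by
    intro t ht hw
    have hk : (Finset.univ.filter fun i => 1 / 2 < t i).card ≤ v.length :=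
      (Finset.card_filter_le _ _).trans (by simp)
    refine ⟨_, Finset.mem_range.mpr (Nat.lt_succ_of_le hk), ?_⟩
    rw [hQd] at ht
    exact mem_preimage_cell ht hw (e _) (he _) (hku _ hk)
  have hdisj : ∀ k k', k < k' → k' ≤ v.length → ∀ t, t ∈ D k → t ∈ D k' → False :=
    fun k k' hkk' hk' t h h' => not_mem_preimage_cell_of_lt (e k) (he k) (e k') (he k')
      (by rw [hku k (by omega), hku k' hk']; exact hkk') t h h'
  rw [chi_eq_of_sub_mem χ hrel (dissect Q D hDs hDsub hcov hdisj), map_sum, Finset.mul_sum]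
  refine Finset.sum_congr rfl fun k hk => ?_
  have hkn : k ≤ v.length := Nat.lt_succ_iff.mp (Finset.mem_range.mp hk)
  rw [piece_value χ hrel hmul I5 hI5d hI5i v k _ _
    (getLast?_map_ne ι h1 (take_reverse_map_not_spec v hv0 k)) (getLast?_map_ne ι h1 (drop_spec v hv1 k))
    (hku k hkn) (by simp) (fun i => by rw [get_take_reverse_map, shift_apply ι h0 h1])
    (fun j => by rw [get_drop_map, shift_apply ι h0 h1]) (Q.restrict (D k) (hDs k) (hDsub k))
    (e k) (he k) rfl (fun t ht => hQi (hDsub k ht)), ← mul_assoc]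
  congr 1
  have := congrArg (Int.cast : ℤ → R) (sign_identity v hkn)
  push_cast at this ⊢
  exact this

end Composition

/-! ## 2. Zero-dimensional path classes -/

/-- A zero-dimensional representation whose domain is the point and whose integrand is `1` there
is congruent to the unit `[pt, 1]`, so has `χ`-value `χ[pt, 1]`. [folklore] -/
theorem chi_of_dim_zero {R : Type} [CommRing R] (χ : KZ.FormalRep →+ R)
    (hrel : ∀ c ∈ KZ.relations, χ c = 0) (hunit1 : χ (KZ.of KZ.IntegralRep.unit) = 1) {n : ℕ}
    (Z0 : KZ.IntegralRep n) (hn : n = 0) (hd : ∀ t, t ∈ Z0.domain)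
    (hi : ∀ t ∈ Z0.domain, Z0.integrand t = 1) : χ (KZ.of Z0) = 1 := by
  subst hn
  have h1 : KZ.of Z0 - KZ.of KZ.IntegralRep.unit ∈ KZ.relations :=
    KZ.of_sub_of_mem_relations_of_eqOn (by ext t; simp [hd]) (fun t ht => by rw [hi t ht]; rfl)
  rw [chi_eq_of_sub_mem χ hrel h1, hunit1]

end Summit.KontsevichZagierPeriods.FurushoPentagon.PentagonInKZ.HalfEdgeUniversal

/-! ## 3. The stub -/

namespace Summit.KontsevichZagierPeriods.FurushoPentagon.PentagonInKZ

open HalfEdgeUniversal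

/-- **Stub `stub_halfEdgeUniversal`** [L]: the UNIVERSAL HALF-EDGE IDENTITY. With
`A(X,Y) := (P 5)(X, Y, 0)` the log-free transport of `X dt/t + Y dt/(t-1)` over `(0, ½)` from the
tangential base point at `0`, `λ := χ[∫₀^{1/2} dt/(t-1)] = [log ½]` and `Φ_χ` the crux series:
`A(Y,X) · e^{λY} · Φ_χ(X,Y) = A(X,Y) · e^{λX}` for all weight-one `X, Y` — the class-level form of
`Φ_KZ = G₁(½)⁻¹ G₀(½)` (composition of the two tangential half-transports at the midpoint
`t = ½`: dissection of the MZV simplex `1 > t₁ > ⋯ > t_n > 0` by the number of `tᵢ > ½`, Fubini,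
the reflection `t ↦ 1 - t`, the antipode of the group-like `A`, and the regularisation algebra
`Shuffle.factorisation` / `MZV.shuffleReg = regFront ∘ regEnd`). [cite: Drinfeld1991, §2] -/
theorem stub_halfEdgeUniversal :
    ∀ (R : Type) [CommRing R] [Algebra ℚ R] (χ : KZ.FormalRep →+ R), (∀ c ∈ KZ.relations, χ c = 0) → (∀ x y : KZ.FormalRep, χ (x * y) = χ x * χ y) → (∃ u : KZ.FormalRep, χ u = 1) → ∀ (Z : List ℕ → KZ.FormalRep), (∀ (u : List ℕ) (hu : MZV.IsAdmissible u), Z u = KZ.of (KZ.mzvRep u hu (KZ.mzvIntegrand_isSemialgebraicFunOn_holds u) (KZ.mzvIntegrand_integrableOn_holds u hu))) → ∀ (φ : NCSeries Bool R), (φ = fun W : List Bool => (-1 : R) ^ (W.count true) * (MZV.shuffleReg W).sum (fun v a => a • (if MZV.IsConvergentWord v then χ (Z (MZV.ofBinaryWord v)) else (0 : R)))) → ∀ (I : (p : Fin 15) → (w : List (Fin 3)) → KZ.IntegralRep w.length), (∀ (p : Fin 15) (w : List (Fin 3)), w.getLast? ≠ some 0 → (I p w).domain = {t | (∀ i, 0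 < t i ∧ t i < (![1/2, 1/2, 1/2, 1/2, 1/2, 1/2, 1/2, 1/2, 1/2, 1/2, 1, 1, 1/2, 1/2, 1/2] : Fin 15 → ℝ) p) ∧ StrictAnti t} ∧ Set.EqOn (I p w).integrand (fun t => ∏ i, 1 / (t i - (![![0, 1, 2], ![0, 1, -1], ![0, 1, 2], ![0, 1, -1], ![0, 1, 2], ![0, 1, 2], ![0, 1, 2], ![0, 1, 2], ![0, 1, 2], ![0, 1, 2], ![0, -1, 2], ![0, -1, 2], ![0, 1, 2], ![0, 1, 2], ![0, 1, 2]] : Fin 15 → Fin 3 → ℝ) p (w.get i))) (I p w).domain) → ∀ (P : Fin 15 → NCSeries (Fin 3) R), (∀ (p : Fin 15) (W : List (Fin 3)), P p W = if W = [] then 1 else Shuffle.pair (fun w => χ (KZ.of (I p w))) (Shuffle.regEnd 0 W)) → (∀ p : Fin 15, NCSeries.IsGroupLike (P p)) → ∀ (N : ℕ) (x y : DrinfeldKohnoTrunc R (Fin 4) N), x ∈ (DrinfeldKohnoTrunc.genSpan : Submodule R (DrinfeldKohnoTrunc R (Fin 4) N)) → y ∈ (DrinfeldKohnoTrunc.genSpan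 : Submodule R (DrinfeldKohnoTrunc R (Fin 4) N)) → NCSeries.evalTrunc N (![y, x, 0] : Fin 3 → DrinfeldKohnoTrunc R (Fin 4) N) (P 5) * truncExp R N (χ (KZ.of (I 5 [1])) • y) * NCSeries.subst₂ N φ x y = NCSeries.evalTrunc N (![x, y, 0] : Fin 3 → DrinfeldKohnoTrunc R (Fin 4) N) (P 5) * truncExp R N (χ (KZ.of (I 5 [1])) • x) := by
  intro R _ _ χ hrel hmul hunit Z hZ φ hφ I hI P hP hG N x y hx hy
  classical
  -- the atlas at path 5, the letters, the unit
  have hI5d : ∀ w : List (Fin 3), w.getLast? ≠ some 0 →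
      (I 5 w).domain = {t | (∀ i, 0 < t i ∧ t i < 1 / 2) ∧ StrictAnti t} := fun w hw => (hI 5 w hw).1
  have hI5i : ∀ w : List (Fin 3), w.getLast? ≠ some 0 → EqOn (I 5 w).integrand
      (fun t => ∏ i, 1 / (t i - (![0, 1, 2] : Fin 3 → ℝ) (w.get i))) (I 5 w).domain :=
    fun w hw => (hI 5 w hw).2
  set ι : Bool → Fin 3 := fun b => if b then 1 else 0 with hι
  have h0 : ι false = 0 := rfl
  have h1 : ι true = 1 := rfl
  have hunit1 : χ (KZ.of KZ.IntegralRep.unit) = 1 := by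
    obtain ⟨u, hu⟩ := hunit
    have := hrel _ (KZ.of_unit_mul_sub_mem_relations u)
    rwa [map_sub, hmul, hu, mul_one, sub_eq_zero] at this
  -- the log-free transport reads honest classes on words not ending in `0`
  have hT : ∀ w : List Bool, (w = [] ∨ w.getLast? = some true) →
      P 5 (w.map ι) = χ (KZ.of (I 5 (w.map ι))) := by
    intro w hw
    rw [hP]
    split_ifs with hnil
    · have hl : (w.map ι).getLast? ≠ some 0 := by rw [hnil]; simp
      have hl0 : (w.map ι).length = 0 := by rw [hnil]; rfl
      refine (chi_of_dim_zero χ hrel hunit1 (I 5 (w.map ι)) hl0 (fun t => ?_) (fun t ht => ?_)).symm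
      · rw [hI5d _ hl]
        exact ⟨fun i => absurd i.isLt (by omega), fun i => absurd i.isLt (by omega)⟩
      · rw [hI5i _ hl ht]
        exact Finset.prod_eq_one fun i _ => absurd i.isLt (by omega)
    · rw [regEnd_eq_single (getLast?_map_ne ι h1 hw), Shuffle.pair_single, one_smul]
  -- the series
  set A₀ : NCSeries Bool R := fun w => P 5 (w.map ι) with hA₀
  set G : NCSeries Bool R := fun w => A₀ (w.map not) with hGdef
  set Ginv : NCSeries Bool R := fun w => (-1 : R) ^ w.length * G w.reverse with hGinv
  set L : R := χ (KZ.of (I 5 [1])) with hL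
  have hA : NCSeries.IsGroupLike A₀ := isGroupLike_comp_map (hG 5) ι
  have hA0 : A₀ [false] = 0 := by
    show P 5 ([false].map ι) = 0
    rw [hP, if_neg (by simp), List.map_singleton, h0, regEnd_singleton_self, Shuffle.pair_zero]
  have hA1 : A₀ [true] = L := by
    show P 5 ([true].map ι) = L
    rw [hT [true] (Or.inr rfl), List.map_singleton, h1]
  -- (‡) the coefficients of `S = G⁻ A₀` on convergent words: the composition formula
  have hS : ∀ u, MZV.IsConvergentWord u →
      (Ginv * A₀) u = (-1 : R) ^ (u.count true) * χ (Z (MZV.ofBinaryWord u)) := by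
    intro u hu
    rcases hu with rfl | ⟨hu0, hu1⟩
    · rw [NCSeries.mul_apply_nil', MZV.ofBinaryWord_nil, hZ [] MZV.isAdmissible_nil, KZ.mzvRep_nil]
      show Ginv [] * A₀ [] = (-1) ^ List.count true [] * χ (KZ.of KZ.IntegralRep.unit)
      rw [hunit1]
      simp [hGinv, hGdef, hA₀, hP]
    · have hne : u ≠ [] := by rintro rfl; simp at hu0
      have hadm : MZV.IsAdmissible (MZV.ofBinaryWord u) :=
        MZV.isAdmissible_ofBinaryWord (by rw [hu0]; decide)
      rw [hZ _ hadm, composition_formula χ hrel hmul (I 5) hI5d hI5i ι h0 h1 u hu0 hu1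
        (MZV.weight_ofBinaryWord hne hu1) (KZ.mzvRep (MZV.ofBinaryWord u) hadm
          (KZ.mzvIntegrand_isSemialgebraicFunOn_holds _) (KZ.mzvIntegrand_integrableOn_holds _ hadm))
        rfl (fun t _ => by simp only [KZ.mzvRep, KZ.mzvIntegrand, MZV.binaryWord_ofBinaryWord hne hu1]),
        NCSeries.mul_apply, NCSeries.sum_splits_eq_sum_range]
      refine Finset.sum_congr rfl fun k hk => ?_
      have hkn : k ≤ u.length := Nat.lt_succ_iff.mp (Finset.mem_range.mp hk)
      simp only [hGinv, hGdef, hA₀]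
      rw [List.length_take, min_eq_left hkn, hT _ (take_reverse_map_not_spec u hu0 k),
        hT _ (drop_spec u hu1 k), mul_assoc]
  -- `Φ = ⟨S, reg ·⟩`, the identity of series, and its evaluation
  have hφ' : ∀ W, φ W = Shuffle.pair (Ginv * A₀) (Shuffle.reg false true W) :=
    phi_eq_pair_reg (Ginv * A₀) φ (fun u => χ (Z (MZV.ofBinaryWord u))) (fun W => by rw [hφ]) hS
  have hser := halfEdgeUniversal_seriesIdentity R A₀ G Ginv φ L hA hA0 hA1 (fun _ => rfl)
    (fun _ => rfl) hφ'
  have hv : ∀ w : List Bool, N < w.length → (w.map (NCSeries.bsub x y)).prod = 0 :=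
    NCSeries.prod_map_bsub_eq_zero_of_mem_genSpan hx hy
  have e1 : NCSeries.evalTrunc N (![y, x, 0] : Fin 3 → DrinfeldKohnoTrunc R (Fin 4) N) (P 5) =
      NCSeries.evalTrunc N (NCSeries.bsub x y) G := by
    rw [evalTrunc_vec3_eq_evalTrunc_bsub N (P 5) y x ι h0 h1, ← NCSeries.evalTrunc_swapXY]
    rfl
  have e2 : NCSeries.evalTrunc N (![x, y, 0] : Fin 3 → DrinfeldKohnoTrunc R (Fin 4) N) (P 5) =
      NCSeries.evalTrunc N (NCSeries.bsub x y) A₀ := evalTrunc_vec3_eq_evalTrunc_bsub N (P 5) x y ι h0 h1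
  have e3 : truncExp R N (L • y) = NCSeries.evalTrunc N (NCSeries.bsub x y) (Shuffle.expLetter true L) :=
    (evalTrunc_expLetter N _ hv true L).symm
  have e4 : truncExp R N (L • x) = NCSeries.evalTrunc N (NCSeries.bsub x y) (Shuffle.expLetter false L) :=
    (evalTrunc_expLetter N _ hv false L).symm
  dsimp only [NCSeries.subst₂]
  rw [e1, e2, e3, e4, ← NCSeries.evalTrunc_mul N _ hv, ← NCSeries.evalTrunc_mul N _ hv,
    ← NCSeries.evalTrunc_mul N _ hv, hser]

end Summit.KontsevichZagierPeriods.FurushoPentagon.PentagonInKZ
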